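import Summits.QuantumFields.YangMills.Theorems.BalabanUVNodesN15FullPropagatorExactSiteSocketS
import Summits.QuantumFields.YangMills.Theorems.BalabanUVNodesN15BackgroundSiteWords

/-!
# Route «BalabanUVNodes», cluster K4 «SpineRates» — node N15 = NE2: THE SITE LAYER WITH THE BACKGROUND LIVE IN THE TwoGrid ENTRY CURRENCY, V — THE SITE SOCKET's THREE LETTERS
# FROM A DRESSED SCALAR LAYER's BLOCK LETTERS (the (3.65) words with the averaging species `F₂ = 0`, dag-n15-c S2 BY NAME), hence `NE2PlusSite` with the background live on
# the general carrier from the `U ≡ 1` scalar layer + its dressed twin ALONE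

Cell `pub-ymgap`, WIDTH SEAT `pub-ymgap-dag-n15-w1` (generation 0; director-ym №197 ∕ HUMAN RULING D-0149; chair R455 (A) ∕ R461; plan g77 `W-SEAT-START-LIST.md` §2 n15 ITEM 1 —
bus CLAIM pub-ymgap INBOX l.24149).  `bears_on: R4∕N15 · K3⁷ SpineGivenEndpointR13SepCoPH (stmt-QuantumFields-20544)`.  Filed `--kind definition --supports stmt-QuantumFields-20544
--as helper` — COUNT-NEUTRAL.  Two data `def`s (`siteEntries`, `sitePert365`), the rest theorems; 0 `sorry`.  Imports this seat's part IV `…N15FullPropagatorExactSiteSocketS` (`sSiteExOn`,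
`ne2PlusSite_sSiteExOn_of_letters`) and dag-n15-c S2 `…N15BackgroundSiteWords` (`siteForm`, `siteForm₀`, `hasMaj_siteC`, `hasMaj_idef_siteForm`; through it `B11SectG.HasMaj`,
`T4EtaRateCoeffDefect.pull`∕`fibre`∕`diagK`, n15-b's `fibAvg`); nothing in the tree is modified.

WHY.  Parts II∕IV take the site perturbations `Pf`, `Pc` as MATRICES on the coarse index with three ENTRY letters.  The lineage's producers speak BLOCK MAJORANTS (`HasMaj` over
King's blocks of the sized unit-torus carrier `unitTorusGeoS`): a `U ≡ 1` scalar layer `G` with its size and two-grid defect (dag-n15-e Σ-a `kingFullProp_uniform_layer` for King's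
`A₀⁻¹`; the genuine [B5] `G′` on the tori of record is the same operator, `reM_greenOp_eq_fineOp`), and a DRESSED layer `X(U) = (1 − GV̂(U))⁻¹G` with the three letters of dag-n15-c S4
(`hasMaj_dressedOp`: size; `hasMaj_dressedOp_sub`: the (3.65) smallness `X − G = GV̂X`; `hasMaj_idef_dressedOp`: two-grid defect).  THIS FILE is the species-independent bridge: from
those block letters ALONE, the (3.65) site perturbation with the averaging species dropped (`F₂ = 0`) — `C(U) = Q(X(X − G) + (X − G)G)Q* = siteForm q 0 0 X − siteForm₀ q G` (S2
`siteForm_sub_siteForm₀`) — read as a matrix on the coarse index carries the THREE ENTRY LETTERS of the site sockets, and part IV's socket then gives `NE2PlusSite` BY NAME with the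
background live.  So a U-seeing site layer for a lane's family costs exactly: its `U ≡ 1` scalar layer with two-grid defect + its dressed layer's S4 letters — one application.

CONTENTS.  §1 def `siteEntries` (the coarse-index matrix of a map on unit-torus site functions), `siteEntries_apply`, `siteEntries_sub`, ★ `abs_siteEntries_le_of_hasMaj` (singleton site blocks ⟹
entries, `T4EtaRateDefectSite.entry_le_of_hasMaj`).  §2 def `sitePert365 q G X := siteForm q 0 0 X − siteForm₀ q G`, `siteForm_zero_zero`, `sitePert365_self` (`X = G` ⟹ `0`), ★
`hasMaj_sitePert365` (SIZE: `≤ (B+β)εc_δ·e^{−(δ∕2)d}`, S2 `hasMaj_siteC` at `r = 0`), `idef_zero_zero`, `sitePert365_sub`, ★★ `hasMaj_sitePert365365_sub` (TWO-GRID: `≤ 2c_δ(Bm + βm₀)·e^{−(δ∕2)d}`,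
S2 `hasMaj_idef_siteForm` twice — the averaging operators intertwine EXACTLY under King's pairing with uniform fibres).  §3 ★★★ **`siteLetters_of_dressedLetters`** — uniformly over a
family: the block letters ⟹ parts II∕IV's `hP` for `Pf i U := siteEntries (sitePert365 (q i ∘ π i) (Gf i) (Xfo i U))`, `Pc i V := siteEntries (sitePert365 (q i) (Gc i) (Xco i V))`, constants
`(δ∕2, (B+β)εc_δ + 1, 2c_δ(Bm + βm₀) + 1, a₁)`.  §4 ★★★ **`ne2PlusSite_sSiteExOn_of_dressedLetters`** — part IV's socket ∘ §3.

HONEST FRAMING.  Count-neutral, species-independent BRIDGE (kernel bookkeeping + S2 ∕ part IV by name); every layer is a HYPOTHESIS here (`Gc∕Gf`, `Xco∕Xfo` and their letters);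
the averaging species `F₂ = Q′(U′U) − Q′` of (3.65) is DROPPED (its words are S2's `F`-terms — a successor adds them with dag-n15-c F7∕F9's species); the perturbation is added to
[B5]'s genuine `Q′G′²Q′*` of parts I∕II (for a lane's `G` to make `siteForm₀ q G` literally that matrix is the lane's dictionary, e.g. part 50 `KRe_torIdx_eq_minimiser` for King's
`A₀⁻¹`).  MODEL level wherever instantiated.  NOT [B9] Thm 3.2 at a general (3.35)-regular `U` (NE2⁺ NOT PRINTED as an η-rate); Node 00's [B9] layers of record are residual —
**N15 is NOT discharged** (typed 28∕28 · discharged 5∕27 of record unchanged); one finite four-torus programme at fixed `ε` — NOT ℝ⁴, NOT infinite volume, NOT OS, NOT a mass gap,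
NOT Clay; R4 closes the conditional finite-𝕋⁴ rung `BalabanLadder.UV` only.  Restate-immune (no Theses import).
-/

set_option autoImplicit false

noncomputable section

open scoped BigOperators Matrix
open Finset

namespace Summit.QuantumFields.YangMills.BalabanUVNodes.N15.SiteLayerBg

open Literature.MathematicalPhysics.QuantumFieldTheory.Balaban1983to89
open Literature.MathematicalPhysics.QuantumFieldTheory.Balaban1983to89.B11SectG (BlockNorm HasMaj RowSum hasMaj_zero)
open Literature.MathematicalPhysics.QuantumFieldTheory.Balaban1983to89.T4EtaRateDefect (idef)
open Literature.MathematicalPhysics.QuantumFieldTheory.Balaban1983to89.T4EtaRateDefectSite (entry entry_le_of_hasMaj)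
open Literature.MathematicalPhysics.QuantumFieldTheory.Balaban1983to89.T4EtaRateCoeffDefect (pull diagK diagK_nonneg fibre)
open Literature.MathematicalPhysics.QuantumFieldTheory.Balaban1983to89.B6RandomWalk (Triangle254)
open Literature.MathematicalPhysics.QuantumFieldTheory.Balaban1983to89.B5Prop11Plancherel (Tor)
open Literature.MathematicalPhysics.QuantumFieldTheory.Balaban1983to89.B4Sect5Torus (tdist)
open Literature.MathematicalPhysics.QuantumFieldTheory.Balaban1983to89.B4Sect5Proof (latticeConst latticeConst_nonneg)
open Literature.MathematicalPhysics.QuantumFieldTheory.Balaban1983to89.B5QGGQ145Bounds (Idx)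
open Literature.MathematicalPhysics.QuantumFieldTheory.Balaban1983to89.B5PBridgeProjection (torIdx)
open Literature.MathematicalPhysics.QuantumFieldTheory.Balaban1983to89.B6UnitTorusCarrier (triangle254_unitTorusGeo rowSum_unitTorusGeo)
open Literature.MathematicalPhysics.QuantumFieldTheory.King1986.Torus (tdistT tdistT_nonneg)
open Summit.QuantumFields.YangMills.BalabanUVNodes.N15.VectorPiece (unitTorusGeoS unitTorusGeoS_dist)
open Summit.QuantumFields.YangMills.BalabanUVNodes.N15.TwoGrid (tdistT_eq_tdist_torIdx)
open Summit.QuantumFields.YangMills.BalabanUVNodes.N15.SiteLayer (siteForm siteForm₀ hasMaj_siteC hasMaj_idef_siteForm hasMaj_add_exp hasMaj_exp_mono)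

variable {d : ℕ} {L : ℕ}

/-! ## §1 The site matrix of a map on unit-torus site functions; entries from a block majorant -/

section SiteMat

variable (M : Fin (d + 1) → ℕ) [∀ μ, NeZero (M μ)]

/-- THE SITE MATRIX of a linear map on the unit-torus site functions, on the coarse index `Idx M`: `T(δ_{q})(p)` through the chart `torIdx`. [folklore] -/
def siteEntries (T : (Tor M → ℝ) →ₗ[ℝ] (Tor M → ℝ)) : Matrix (Idx M) (Idx M) ℝ :=
  fun p q => entry T ((torIdx M).symm p) ((torIdx M).symm q)

/-- Unfolding of `siteEntries`. [folklore] -/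
theorem siteEntries_apply (T : (Tor M → ℝ) →ₗ[ℝ] (Tor M → ℝ)) (p q : Idx M) :
    siteEntries M T p q = T (Pi.single ((torIdx M).symm q) 1) ((torIdx M).symm p) := rfl

/-- `siteEntries` is additive-group linear in the map: differences. [folklore] -/
theorem siteEntries_sub (T T' : (Tor M → ℝ) →ₗ[ℝ] (Tor M → ℝ)) : siteEntries M (T - T') = siteEntries M T - siteEntries M T' := by
  ext p q
  simp only [siteEntries_apply, Matrix.sub_apply, LinearMap.sub_apply, Pi.sub_apply]

/-- ★ **ENTRIES FROM A BLOCK MAJORANT ON THE SIZED UNIT-TORUS CARRIER** (singleton site blocks): `T ≤ A·e^{−ρd}` between the sharp site norms of `unitTorusGeoS L k M M_sz`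
⟹ `|siteEntries T (p,q)| ≤ A·e^{−ρ·tdist(p,q)}` (`T4EtaRateDefectSite.entry_le_of_hasMaj`, `tdistT = tdist ∘ torIdx`). [folklore] -/
theorem abs_siteEntries_le_of_hasMaj (k : ℕ) (Msz : ℝ) {T : (Tor M → ℝ) →ₗ[ℝ] (Tor M → ℝ)} {A ρ : ℝ}
    (h : HasMaj (BlockNorm.ofBlocks (unitTorusGeoS L k M Msz) (fun y : Tor M => y)) (BlockNorm.ofBlocks (unitTorusGeoS L k M Msz) (fun y : Tor M => y)) T
      (fun y y' => A * Real.exp (-(ρ * (unitTorusGeoS L k M Msz).dist y y')))) (p q : Idx M) :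
    |siteEntries M T p q| ≤ A * Real.exp (-(ρ * tdist M p q)) := by
  have h1 := entry_le_of_hasMaj (g := unitTorusGeoS L k M Msz) (fun y : Tor M => y) (fun y : Tor M => y) h ((torIdx M).symm p) ((torIdx M).symm q)
  have hd : (unitTorusGeoS L k M Msz).dist ((torIdx M).symm p) ((torIdx M).symm q) = tdist M p q := by
    rw [unitTorusGeoS_dist, tdistT_eq_tdist_torIdx, Equiv.apply_symm_apply, Equiv.apply_symm_apply]
  rw [hd] at h1
  exact h1

end SiteMat

/-! ## §2 The (3.65) site perturbation with `F₂ = 0`: `Q(X(X − G) + (X − G)G)Q*` — size letter and two-grid letter from block letters -/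

section Words

variable {Xc : Type} [Fintype Xc] (M : Fin (d + 1) → ℕ)

/-- **THE SITE PERTURBATION OF (3.65) WITH THE AVERAGING SPECIES `F₂ = 0`**: `siteForm q 0 0 X − siteForm₀ q G = Q∘(X∘(X − G) + (X − G)∘G)∘Q*` (dag-n15-c S2 `siteForm_sub_siteForm₀`)
for a `U ≡ 1` layer `G` and a dressed layer `X` on the fine-site carrier `Xc` over the unit-torus sites (`q` = the block map). [cite: Balaban1985BackgroundPropagators, (3.65) p.403 (shape)] -/
def sitePert365 (q : Xc → Tor M) (G Xo : (Xc → ℝ) →ₗ[ℝ] (Xc → ℝ)) : (Tor M → ℝ) →ₗ[ℝ] (Tor M → ℝ) :=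
  siteForm q 0 0 Xo - siteForm₀ q G

/-- `siteForm q 0 0 G = siteForm₀ q G` (the undressed words). [folklore] -/
theorem siteForm_zero_zero (q : Xc → Tor M) (G : (Xc → ℝ) →ₗ[ℝ] (Xc → ℝ)) : siteForm q 0 0 G = siteForm₀ q G := by
  unfold siteForm siteForm₀
  rw [add_zero, add_zero]

/-- At `X = G` the site perturbation vanishes. [folklore] -/
theorem sitePert365_self (q : Xc → Tor M) (G : (Xc → ℝ) →ₗ[ℝ] (Xc → ℝ)) : sitePert365 M q G G = 0 := by
  unfold sitePert365
  rw [siteForm_zero_zero, sub_self]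

variable (L)

/-- ★ **THE SIZE LETTER** of the site perturbation on the sized unit-torus carrier `g = unitTorusGeoS L k M M_sz` (fine-site blocks `q`, singleton site blocks): from `X ≤ B·e^{−δd}`,
`G ≤ β·e^{−δd}`, `X − G ≤ ε·e^{−δd}` (`B, β, ε ≥ 0`, `δ > 0`): `sitePert365 q G X ≤ (B + β)·ε·c_δ·e^{−(δ∕2)d}`, `c_δ = K_{d+1}(δ∕2)` King's torus sum (dag-n15-c S2 `hasMaj_siteC` at `r = 0`).
[cite: Balaban1985BackgroundPropagators, (3.66) p.403 (shape)] -/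
theorem hasMaj_sitePert365 [∀ μ, NeZero (M μ)] (k : ℕ) (Msz : ℝ) (q : Xc → Tor M) {G Xo : (Xc → ℝ) →ₗ[ℝ] (Xc → ℝ)} {B β ε δ : ℝ} (hB : 0 ≤ B) (hβ : 0 ≤ β) (hε : 0 ≤ ε) (hδ : 0 < δ)
    (hX : HasMaj (BlockNorm.ofBlocks (unitTorusGeoS L k M Msz) q) (BlockNorm.ofBlocks (unitTorusGeoS L k M Msz) q) Xo
      (fun y y' => B * Real.exp (-(δ * (unitTorusGeoS L k M Msz).dist y y'))))
    (hG : HasMaj (BlockNorm.ofBlocks (unitTorusGeoS L k M Msz) q) (BlockNorm.ofBlocks (unitTorusGeoS L k M Msz) q) G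
      (fun y y' => β * Real.exp (-(δ * (unitTorusGeoS L k M Msz).dist y y'))))
    (hE : HasMaj (BlockNorm.ofBlocks (unitTorusGeoS L k M Msz) q) (BlockNorm.ofBlocks (unitTorusGeoS L k M Msz) q) (Xo - G)
      (fun y y' => ε * Real.exp (-(δ * (unitTorusGeoS L k M Msz).dist y y')))) :
    HasMaj (BlockNorm.ofBlocks (unitTorusGeoS L k M Msz) (fun y : Tor M => y)) (BlockNorm.ofBlocks (unitTorusGeoS L k M Msz) (fun y : Tor M => y)) (sitePert365 M q G Xo)
      (fun y y' => (B + β) * ε * latticeConst (d + 1) (δ / 2) * Real.exp (-(δ / 2 * (unitTorusGeoS L k M Msz).dist y y'))) := by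
  have hK : 0 ≤ latticeConst (d + 1) (δ / 2) := latticeConst_nonneg _ (by positivity)
  have h := hasMaj_siteC (g := unitTorusGeoS L k M Msz) (σ := δ / 2) (cr := latticeConst (d + 1) (δ / 2)) (triangle254_unitTorusGeo L k M)
    (fun a b => tdistT_nonneg M a b) (rowSum_unitTorusGeo L k M (half_pos hδ)) (by positivity) hK q (fun y : Tor M => y) q (fun _ => rfl)
    (F := 0) (Fs := 0) hB hβ hε le_rfl (by positivity : (0 : ℝ) ≤ δ / 2) (by linarith) hX hG hE
    ((hasMaj_zero _ _).mono fun _ _ => diagK_nonneg (fun _ => le_rfl) _ _) ((hasMaj_zero _ _).mono fun _ _ => diagK_nonneg (fun _ => le_rfl) _ _)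
  refine h.mono fun y y' => le_of_eq ?_
  show (0 * (B * B * (1 + 0)) + B * B * 0 + (B + β) * ε) * latticeConst (d + 1) (δ / 2) * Real.exp (-(δ / 2 * (unitTorusGeoS L k M Msz).dist y y')) = _
  ring

/-- `idef` of two zero maps vanishes. [folklore] -/
theorem idef_zero_zero {F₁ F₁' F₂ F₂' : Type} [AddCommGroup F₁] [Module ℝ F₁] [AddCommGroup F₁'] [Module ℝ F₁'] [AddCommGroup F₂] [Module ℝ F₂]
    [AddCommGroup F₂'] [Module ℝ F₂'] (τ₁ : F₁ →ₗ[ℝ] F₁') (τ₂ : F₂ →ₗ[ℝ] F₂') :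
    idef τ₁ τ₂ (0 : F₁' →ₗ[ℝ] F₂') (0 : F₁ →ₗ[ℝ] F₂) = 0 := by
  unfold idef
  rw [LinearMap.zero_comp, LinearMap.comp_zero, sub_zero]

/-- **THE TWO-GRID DIFFERENCE OF THE SITE PERTURBATIONS IS A DIFFERENCE OF TWO η-DEFECTS** through the identity transport of the common site lattice: `C′ − C =
𝔇(K′_X, K_X) − 𝔇(K′_G, K_G)` with `K_X = siteForm q 0 0 X`, `K_G = siteForm q 0 0 G = siteForm₀ q G`. [folklore] -/
theorem sitePert365_sub {Xf : Type} [Fintype Xf] (q : Xc → Tor M) (π : Xf → Xc) (G Xo : (Xc → ℝ) →ₗ[ℝ] (Xc → ℝ)) (G' Xo' : (Xf → ℝ) →ₗ[ℝ] (Xf → ℝ)) :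
    sitePert365 M (q ∘ π) G' Xo' - sitePert365 M q G Xo =
      idef LinearMap.id LinearMap.id (siteForm (q ∘ π) 0 0 Xo') (siteForm q 0 0 Xo) - idef LinearMap.id LinearMap.id (siteForm (q ∘ π) 0 0 G') (siteForm q 0 0 G) := by
  unfold sitePert365 idef
  rw [siteForm_zero_zero, siteForm_zero_zero, siteForm_zero_zero, siteForm_zero_zero, LinearMap.comp_id, LinearMap.id_comp, LinearMap.comp_id, LinearMap.id_comp]
  abel

/-- ★ **THE TWO-GRID LETTER** of the site perturbations (fine `(q ∘ π, G′, X′)` against coarse `(q, G, X)`, King's pairing `π` with UNIFORM fibres `#π⁻¹x = N ≥ 1`): from the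
layers' sizes `X, X′ ≤ B·e^{−δd}`, `G, G′ ≤ β·e^{−δd}` and their two-grid defects `𝔇^π(X′, X) ≤ m·e^{−δd}`, `𝔇^π(G′, G) ≤ m₀·e^{−δd}` (`B, β, m, m₀ ≥ 0`, `δ > 0`):
`C′ − C ≤ 2c_δ(B·m + β·m₀)·e^{−(δ∕2)d}` between the sharp site norms — dag-n15-c S2 `hasMaj_idef_siteForm` twice (`F₂ ≡ 0`: the averaging operators intertwine EXACTLY,
`Q′τ = Q`, `Q′* = τQ*`).  Rate-small exactly when `m`, `m₀` are. [cite: Balaban1985BackgroundPropagators, (3.65)–(3.66) p.403 (mechanism); King1986, p.664 (pairing convention)] -/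
theorem hasMaj_sitePert365365_sub [∀ μ, NeZero (M μ)] [DecidableEq Xc] {Xf : Type} [Fintype Xf] (k : ℕ) (Msz : ℝ) (q : Xc → Tor M) (π : Xf → Xc) {N : ℕ} (hN : N ≠ 0)
    (hfib : ∀ x, (fibre π x).card = N) {G Xo : (Xc → ℝ) →ₗ[ℝ] (Xc → ℝ)} {G' Xo' : (Xf → ℝ) →ₗ[ℝ] (Xf → ℝ)} {B β m m₀ δ : ℝ}
    (hB : 0 ≤ B) (hβ : 0 ≤ β) (hm : 0 ≤ m) (hm₀ : 0 ≤ m₀) (hδ : 0 < δ)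
    (hX : HasMaj (BlockNorm.ofBlocks (unitTorusGeoS L k M Msz) q) (BlockNorm.ofBlocks (unitTorusGeoS L k M Msz) q) Xo
      (fun y y' => B * Real.exp (-(δ * (unitTorusGeoS L k M Msz).dist y y'))))
    (hX' : HasMaj (BlockNorm.ofBlocks (unitTorusGeoS L k M Msz) (q ∘ π)) (BlockNorm.ofBlocks (unitTorusGeoS L k M Msz) (q ∘ π)) Xo'
      (fun y y' => B * Real.exp (-(δ * (unitTorusGeoS L k M Msz).dist y y'))))
    (hDX : HasMaj (BlockNorm.ofBlocks (unitTorusGeoS L k M Msz) q) (BlockNorm.ofBlocks (unitTorusGeoS L k M Msz) (q ∘ π)) (idef (pull π) (pull π) Xo' Xo)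
      (fun y y' => m * Real.exp (-(δ * (unitTorusGeoS L k M Msz).dist y y'))))
    (hG : HasMaj (BlockNorm.ofBlocks (unitTorusGeoS L k M Msz) q) (BlockNorm.ofBlocks (unitTorusGeoS L k M Msz) q) G
      (fun y y' => β * Real.exp (-(δ * (unitTorusGeoS L k M Msz).dist y y'))))
    (hG' : HasMaj (BlockNorm.ofBlocks (unitTorusGeoS L k M Msz) (q ∘ π)) (BlockNorm.ofBlocks (unitTorusGeoS L k M Msz) (q ∘ π)) G'
      (fun y y' => β * Real.exp (-(δ * (unitTorusGeoS L k M Msz).dist y y'))))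
    (hDG : HasMaj (BlockNorm.ofBlocks (unitTorusGeoS L k M Msz) q) (BlockNorm.ofBlocks (unitTorusGeoS L k M Msz) (q ∘ π)) (idef (pull π) (pull π) G' G)
      (fun y y' => m₀ * Real.exp (-(δ * (unitTorusGeoS L k M Msz).dist y y')))) :
    HasMaj (BlockNorm.ofBlocks (unitTorusGeoS L k M Msz) (fun y : Tor M => y)) (BlockNorm.ofBlocks (unitTorusGeoS L k M Msz) (fun y : Tor M => y))
      (sitePert365 M (q ∘ π) G' Xo' - sitePert365 M q G Xo)
      (fun y y' => 2 * latticeConst (d + 1) (δ / 2) * (B * m + β * m₀) * Real.exp (-(δ / 2 * (unitTorusGeoS L k M Msz).dist y y'))) := by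
  have hK : 0 ≤ latticeConst (d + 1) (δ / 2) := latticeConst_nonneg _ (by positivity)
  have htri := triangle254_unitTorusGeo L k M
  have hrow := rowSum_unitTorusGeo L k M (half_pos hδ)
  have hd : ∀ a b : (unitTorusGeoS L k M Msz).Site, 0 ≤ (unitTorusGeoS L k M Msz).dist a b := fun a b => tdistT_nonneg M a b
  have z1 : HasMaj (BlockNorm.ofBlocks (unitTorusGeoS L k M Msz) (fun y : Tor M => y)) (BlockNorm.ofBlocks (unitTorusGeoS L k M Msz) q)
      (0 : (Tor M → ℝ) →ₗ[ℝ] (Xc → ℝ)) (diagK fun _ => 0) := (hasMaj_zero _ _).mono fun _ _ => diagK_nonneg (fun _ => le_rfl) _ _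
  have z2 : HasMaj (BlockNorm.ofBlocks (unitTorusGeoS L k M Msz) (q ∘ π)) (BlockNorm.ofBlocks (unitTorusGeoS L k M Msz) (fun y : Tor M => y))
      (0 : (Xf → ℝ) →ₗ[ℝ] (Tor M → ℝ)) (diagK fun _ => 0) := (hasMaj_zero _ _).mono fun _ _ => diagK_nonneg (fun _ => le_rfl) _ _
  have z3 : HasMaj (BlockNorm.ofBlocks (unitTorusGeoS L k M Msz) (fun y : Tor M => y)) (BlockNorm.ofBlocks (unitTorusGeoS L k M Msz) (q ∘ π))
      (0 : (Tor M → ℝ) →ₗ[ℝ] (Xf → ℝ)) (diagK fun _ => 0) := (hasMaj_zero _ _).mono fun _ _ => diagK_nonneg (fun _ => le_rfl) _ _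
  have z4 : HasMaj (BlockNorm.ofBlocks (unitTorusGeoS L k M Msz) q) (BlockNorm.ofBlocks (unitTorusGeoS L k M Msz) (fun y : Tor M => y))
      (idef (pull π) LinearMap.id (0 : (Xf → ℝ) →ₗ[ℝ] (Tor M → ℝ)) (0 : (Xc → ℝ) →ₗ[ℝ] (Tor M → ℝ))) (diagK fun _ => 0) := by
    rw [idef_zero_zero]; exact (hasMaj_zero _ _).mono fun _ _ => diagK_nonneg (fun _ => le_rfl) _ _
  have z5 : HasMaj (BlockNorm.ofBlocks (unitTorusGeoS L k M Msz) (fun y : Tor M => y)) (BlockNorm.ofBlocks (unitTorusGeoS L k M Msz) (q ∘ π))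
      (idef LinearMap.id (pull π) (0 : (Tor M → ℝ) →ₗ[ℝ] (Xf → ℝ)) (0 : (Tor M → ℝ) →ₗ[ℝ] (Xc → ℝ))) (diagK fun _ => 0) := by
    rw [idef_zero_zero]; exact (hasMaj_zero _ _).mono fun _ _ => diagK_nonneg (fun _ => le_rfl) _ _
  have h1 := hasMaj_idef_siteForm (g := unitTorusGeoS L k M Msz) (σ := δ / 2) (cr := latticeConst (d + 1) (δ / 2)) htri hd hrow (by positivity)
    q (fun y : Tor M => y) q π (fun _ => rfl) hN hfib hB hm le_rfl le_rfl (by positivity : (0 : ℝ) ≤ δ / 2) (by linarith) hX hX' hDX z1 z2 z3 z4 z5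
  have h2 := hasMaj_idef_siteForm (g := unitTorusGeoS L k M Msz) (σ := δ / 2) (cr := latticeConst (d + 1) (δ / 2)) htri hd hrow (by positivity)
    q (fun y : Tor M => y) q π (fun _ => rfl) hN hfib hβ hm₀ le_rfl le_rfl (by positivity : (0 : ℝ) ≤ δ / 2) (by linarith) hG hG' hDG z1 z2 z3 z4 z5
  rw [sitePert365_sub]
  refine (h1.sub h2).mono fun y y' => le_of_eq ?_
  ring

end Words

/-! ## §3 ★★★ The three site letters of parts II∕IV from a dressed scalar layer's block letters, uniformly over a family -/

section Letters

variable {I : Type} (Mn : I → Fin (d + 1) → ℕ) [hMn0 : ∀ i μ, NeZero (Mn i μ)] (kk : I → ℕ) (Msz : I → ℝ)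
  (Xc Xf : I → Type) [∀ i, Fintype (Xc i)] [∀ i, DecidableEq (Xc i)] [∀ i, Fintype (Xf i)] (q : ∀ i, Xc i → Tor (Mn i)) (π : ∀ i, Xf i → Xc i)
  (Bc Bf : I → B9.Backgrounds) (avg : ∀ i, (Bf i).Cfg → (Bc i).Cfg)
  (Gc : ∀ i, (Xc i → ℝ) →ₗ[ℝ] (Xc i → ℝ)) (Gf : ∀ i, (Xf i → ℝ) →ₗ[ℝ] (Xf i → ℝ))
  (Xco : ∀ i, (Bc i).Cfg → (Xc i → ℝ) →ₗ[ℝ] (Xc i → ℝ)) (Xfo : ∀ i, (Bf i).Cfg → (Xf i → ℝ) →ₗ[ℝ] (Xf i → ℝ))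

/-- ★★★ **THE SITE LETTERS FROM A DRESSED SCALAR LAYER's BLOCK LETTERS.**  Data per index `i`: the sized unit-torus carrier `g_i = unitTorusGeoS L (k i) (M i) (M_sz i)`, a coarse fine-site
carrier `Xc i` blocked by `q i`, a fine one `Xf i` paired to it by `π i` with UNIFORM fibres, the `U ≡ 1` scalar layer `Gc i` ∕ `Gf i` of the two runs and the DRESSED layers
`Xco i V` ∕ `Xfo i U` (configuration-dependent).  LETTERS (uniform constants; `r_i = (L^{k i})^{−γ_P}`): `Gc, Gf ≤ β·e^{−δd}`, `𝔇^π(Gf, Gc) ≤ m₀·r_i·e^{−δd}`, and for `α₀ ≤ a₁`, `U` regular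
at level `c₃₅`: `Xco(Ū), Xfo(U) ≤ B·e^{−δd}`, `Xco(Ū) − Gc, Xfo(U) − Gf ≤ εα₀·e^{−δd}` (the (3.65) smallness `G′(U′U) − G′ = G′V′G′(U′U)`), `𝔇^π(Xfo(U), Xco(Ū)) ≤ m·r_i·e^{−δd}`
(`Ū = avg i U`).  CONCLUSION: the three letters of the site sockets (parts II∕IV) for the site perturbations `Pf i U := siteEntries (sitePert365 (q i ∘ π i) (Gf i) (Xfo i U))`,
`Pc i V := siteEntries (sitePert365 (q i) (Gc i) (Xco i V))`, with `(δ_P, ζ, τ, a₁) = (δ∕2, (B+β)εc_δ + 1, 2c_δ(Bm + βm₀) + 1, a₁)`.  §2 by name + `abs_siteEntries_le_of_hasMaj`.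
[cite: Balaban1985BackgroundPropagators, (3.65)–(3.67) p.403 (mechanism); King1986, p.664 (pairing)] -/
theorem siteLetters_of_dressedLetters (c35 : ℝ) {γP : ℝ}
    (hfib : ∀ i, ∃ N : ℕ, N ≠ 0 ∧ ∀ x, (fibre (π i) x).card = N)
    (hL : ∃ β B ε m m₀ δ a₁ : ℝ, 0 ≤ β ∧ 0 ≤ B ∧ 0 < ε ∧ 0 ≤ m ∧ 0 ≤ m₀ ∧ 0 < δ ∧ 0 < a₁ ∧ ∀ i : I,
      HasMaj (BlockNorm.ofBlocks (unitTorusGeoS L (kk i) (Mn i) (Msz i)) (q i)) (BlockNorm.ofBlocks (unitTorusGeoS L (kk i) (Mn i) (Msz i)) (q i)) (Gc i)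
        (fun y y' => β * Real.exp (-(δ * (unitTorusGeoS L (kk i) (Mn i) (Msz i)).dist y y'))) ∧
      HasMaj (BlockNorm.ofBlocks (unitTorusGeoS L (kk i) (Mn i) (Msz i)) (q i ∘ π i)) (BlockNorm.ofBlocks (unitTorusGeoS L (kk i) (Mn i) (Msz i)) (q i ∘ π i)) (Gf i)
        (fun y y' => β * Real.exp (-(δ * (unitTorusGeoS L (kk i) (Mn i) (Msz i)).dist y y'))) ∧
      HasMaj (BlockNorm.ofBlocks (unitTorusGeoS L (kk i) (Mn i) (Msz i)) (q i)) (BlockNorm.ofBlocks (unitTorusGeoS L (kk i) (Mn i) (Msz i)) (q i ∘ π i))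
        (idef (pull (π i)) (pull (π i)) (Gf i) (Gc i)) (fun y y' => m₀ * ((L : ℝ) ^ kk i) ^ (-γP) * Real.exp (-(δ * (unitTorusGeoS L (kk i) (Mn i) (Msz i)).dist y y'))) ∧
      ∀ (α₀ : ℝ), 0 < α₀ → α₀ ≤ a₁ → ∀ U : (Bf i).Cfg, (Bf i).Reg335 c35 α₀ U →
        HasMaj (BlockNorm.ofBlocks (unitTorusGeoS L (kk i) (Mn i) (Msz i)) (q i)) (BlockNorm.ofBlocks (unitTorusGeoS L (kk i) (Mn i) (Msz i)) (q i)) (Xco i (avg i U))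
          (fun y y' => B * Real.exp (-(δ * (unitTorusGeoS L (kk i) (Mn i) (Msz i)).dist y y'))) ∧
        HasMaj (BlockNorm.ofBlocks (unitTorusGeoS L (kk i) (Mn i) (Msz i)) (q i ∘ π i)) (BlockNorm.ofBlocks (unitTorusGeoS L (kk i) (Mn i) (Msz i)) (q i ∘ π i)) (Xfo i U)
          (fun y y' => B * Real.exp (-(δ * (unitTorusGeoS L (kk i) (Mn i) (Msz i)).dist y y'))) ∧
        HasMaj (BlockNorm.ofBlocks (unitTorusGeoS L (kk i) (Mn i) (Msz i)) (q i)) (BlockNorm.ofBlocks (unitTorusGeoS L (kk i) (Mn i) (Msz i)) (q i)) (Xco i (avg i U) - Gc i)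
          (fun y y' => ε * α₀ * Real.exp (-(δ * (unitTorusGeoS L (kk i) (Mn i) (Msz i)).dist y y'))) ∧
        HasMaj (BlockNorm.ofBlocks (unitTorusGeoS L (kk i) (Mn i) (Msz i)) (q i ∘ π i)) (BlockNorm.ofBlocks (unitTorusGeoS L (kk i) (Mn i) (Msz i)) (q i ∘ π i))
          (Xfo i U - Gf i) (fun y y' => ε * α₀ * Real.exp (-(δ * (unitTorusGeoS L (kk i) (Mn i) (Msz i)).dist y y'))) ∧
        HasMaj (BlockNorm.ofBlocks (unitTorusGeoS L (kk i) (Mn i) (Msz i)) (q i)) (BlockNorm.ofBlocks (unitTorusGeoS L (kk i) (Mn i) (Msz i)) (q i ∘ π i))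
          (idef (pull (π i)) (pull (π i)) (Xfo i U) (Xco i (avg i U)))
          (fun y y' => m * ((L : ℝ) ^ kk i) ^ (-γP) * Real.exp (-(δ * (unitTorusGeoS L (kk i) (Mn i) (Msz i)).dist y y')))) :
    ∃ δP ζ τ a₁ : ℝ, 0 < δP ∧ 0 < ζ ∧ 0 < τ ∧ 0 < a₁ ∧
      ∀ (i : I) (α₀ : ℝ), 0 < α₀ → α₀ ≤ a₁ → ∀ U : (Bf i).Cfg, (Bf i).Reg335 c35 α₀ U →
        (∀ p p' : Idx (Mn i), |siteEntries (Mn i) (sitePert365 (Mn i) (q i) (Gc i) (Xco i (avg i U))) p p'| ≤ ζ * α₀ * Real.exp (-(δP * tdist (Mn i) p p'))) ∧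
        (∀ p p' : Idx (Mn i), |siteEntries (Mn i) (sitePert365 (Mn i) (q i ∘ π i) (Gf i) (Xfo i U)) p p'| ≤ ζ * α₀ * Real.exp (-(δP * tdist (Mn i) p p'))) ∧
        (∀ p p' : Idx (Mn i), |siteEntries (Mn i) (sitePert365 (Mn i) (q i ∘ π i) (Gf i) (Xfo i U)) p p' - siteEntries (Mn i) (sitePert365 (Mn i) (q i) (Gc i) (Xco i (avg i U))) p p'|
            ≤ τ * ((L : ℝ) ^ kk i) ^ (-γP) * Real.exp (-(δP * tdist (Mn i) p p'))) := by
  obtain ⟨β, B, ε, m, m₀, δ, a₁, hβ, hB, hε, hm, hm₀, hδ, ha₁, H⟩ := hL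
  have hLr : (0 : ℝ) ≤ (L : ℝ) := Nat.cast_nonneg _
  obtain ⟨c, hcdef⟩ : ∃ c : ℝ, c = latticeConst (d + 1) (δ / 2) := ⟨_, rfl⟩
  have hc : 0 ≤ c := hcdef ▸ latticeConst_nonneg _ (by positivity)
  refine ⟨δ / 2, (B + β) * ε * c + 1, 2 * c * (B * m + β * m₀) + 1, a₁, half_pos hδ, by positivity, by positivity, ha₁, fun i α₀ hα₀ hαa₁ U hreg => ?_⟩
  obtain ⟨hGc, hGf, hDG, HU⟩ := H i
  obtain ⟨hXc, hXf, hEc, hEf, hDX⟩ := HU α₀ hα₀ hαa₁ U hreg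
  obtain ⟨N, hN, hfibi⟩ := hfib i
  have hr : 0 ≤ ((L : ℝ) ^ kk i) ^ (-γP) := Real.rpow_nonneg (pow_nonneg hLr _) _
  have hεα : 0 ≤ ε * α₀ := by positivity
  -- the two size letters (S2 `hasMaj_siteC` at `r = 0`)
  have hPc := hasMaj_sitePert365 L (Mn i) (kk i) (Msz i) (q i) hB hβ hεα hδ hXc hGc hEc
  have hPf := hasMaj_sitePert365 L (Mn i) (kk i) (Msz i) (q i ∘ π i) hB hβ hεα hδ hXf hGf hEf
  -- the two-grid letter (S2 `hasMaj_idef_siteForm` twice)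
  have hPP := hasMaj_sitePert365365_sub L (Mn i) (kk i) (Msz i) (q i) (π i) hN hfibi hB hβ (mul_nonneg hm hr) (mul_nonneg hm₀ hr) hδ hXc hXf hDX hGc hGf hDG
  refine ⟨fun p p' => ?_, fun p p' => ?_, fun p p' => ?_⟩
  · refine (abs_siteEntries_le_of_hasMaj (L := L) (Mn i) (kk i) (Msz i) hPc p p').trans ?_
    rw [← hcdef]
    have hE := Real.exp_nonneg (-(δ / 2 * tdist (Mn i) p p'))
    have : (B + β) * (ε * α₀) * c ≤ ((B + β) * ε * c + 1) * α₀ := by nlinarith [mul_nonneg (mul_nonneg (add_nonneg hB hβ) hε.le) hc]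
    nlinarith
  · refine (abs_siteEntries_le_of_hasMaj (L := L) (Mn i) (kk i) (Msz i) hPf p p').trans ?_
    rw [← hcdef]
    have hE := Real.exp_nonneg (-(δ / 2 * tdist (Mn i) p p'))
    have : (B + β) * (ε * α₀) * c ≤ ((B + β) * ε * c + 1) * α₀ := by nlinarith [mul_nonneg (mul_nonneg (add_nonneg hB hβ) hε.le) hc]
    nlinarith
  · rw [← Matrix.sub_apply, ← siteEntries_sub]
    refine (abs_siteEntries_le_of_hasMaj (L := L) (Mn i) (kk i) (Msz i) hPP p p').trans ?_
    rw [← hcdef]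
    have hE := Real.exp_nonneg (-(δ / 2 * tdist (Mn i) p p'))
    have h1 : 2 * c * (B * (m * ((L : ℝ) ^ kk i) ^ (-γP)) + β * (m₀ * ((L : ℝ) ^ kk i) ^ (-γP))) = (2 * c * (B * m + β * m₀)) * ((L : ℝ) ^ kk i) ^ (-γP) := by ring
    rw [h1]
    have h2 : (2 * c * (B * m + β * m₀)) * ((L : ℝ) ^ kk i) ^ (-γP) ≤ (2 * c * (B * m + β * m₀) + 1) * ((L : ℝ) ^ kk i) ^ (-γP) :=
      mul_le_mul_of_nonneg_right (by linarith) hr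
    exact mul_le_mul_of_nonneg_right h2 hE

end Letters

/-! ## §4 ★★★ The site layer over the general carrier from a dressed scalar layer's block letters (part IV's socket ∘ §3) -/

section Socket

open Literature.MathematicalPhysics.QuantumFieldTheory.Balaban1983to89.T4EtaRate (PairedInstance EtaPairing NE2PlusSite)
open Literature.MathematicalPhysics.QuantumFieldTheory.King1986 (aK)
open Summit.QuantumFields.YangMills.BalabanUVNodes.N15.OperatorReadout (opGeo)

variable [NeZero L] {I : Type} (Mn : I → Fin (d + 1) → ℕ) [hMn0 : ∀ i μ, NeZero (Mn i μ)] (kk mm : I → ℕ) (Msz : I → ℝ) (X : I → Type) [∀ i, Fintype (X i)]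
  (blk : ∀ i, X i → Tor (Mn i)) (gf : I → B9.Geometry) (Bc Bf : I → B9.Backgrounds)
  (Xc Xf : I → Type) [∀ i, Fintype (Xc i)] [∀ i, DecidableEq (Xc i)] [∀ i, Fintype (Xf i)] (q : ∀ i, Xc i → Tor (Mn i)) (π : ∀ i, Xf i → Xc i)
  (Gc : ∀ i, (Xc i → ℝ) →ₗ[ℝ] (Xc i → ℝ)) (Gf : ∀ i, (Xf i → ℝ) →ₗ[ℝ] (Xf i → ℝ))
  (Xco : ∀ i, (Bc i).Cfg → (Xc i → ℝ) →ₗ[ℝ] (Xc i → ℝ)) (Xfo : ∀ i, (Bf i).Cfg → (Xf i → ℝ) →ₗ[ℝ] (Xf i → ℝ))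

/-- ★★★ **`NE2PlusSite` WITH THE BACKGROUND LIVE FROM A DRESSED SCALAR LAYER's BLOCK LETTERS** — part IV's socket `ne2PlusSite_sSiteExOn_of_letters` fed by §3: on a family
`pi i = ⟨opGeo (unitTorusGeoS L (k i) (M i) (M_sz i)) (X i) (blk i), gf i, Bc i, Bf i, pair i⟩` (tori of record `M i = 2L^{m_T i}`, `k i ≥ 1`, guard scales `(gf i).M ≥ 1`), the
η-difference of the dressed site kernels `(Q′G′²Q′*_{L^mL^k,a_{k+m}} + P_f(U))⁻¹ − (Q′G′²Q′*_{L^k,a_k} + P_c(Ū))⁻¹` with the (3.65) site perturbations `P = siteEntries (Q(X(X − G) + (X − G)G)Q*)`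
of the two runs satisfies `NE2PlusSite d′ p c₃₅` — the letters of `G`, `X(U)` (sizes, (3.65) smallness, two-grid defects through King's pairing with uniform fibres) being the ONLY
input.  The letters are HYPOTHESES here; a supplier = a `U ≡ 1` scalar layer with its two-grid defect (e.g. dag-n15-e Σ-a `kingFullProp_uniform_layer`) + a dressed layer via
dag-n15-c S4 `hasMaj_dressedOp(_sub)`∕`hasMaj_idef_dressedOp` from a species' letters. [cite: Balaban1985BackgroundPropagators, Thm 3.2 (3.48) p.398 + Thm 3.14 pp.426–427
(quantifier template), (3.65)–(3.67) p.403 (mechanism); King1986, Prop. 3.8 (3.71) p.664, p.664 (pairing); CombesThomas1973, §II] -/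
theorem ne2PlusSite_sSiteExOn_of_dressedLetters (hLodd : Odd L) (hL2 : 2 ≤ L) {aS : ℝ} (haS : 0 < aS) (c35 : ℝ) (d' : ℕ) (p : ℝ)
    {mT : I → ℕ} (hMnT : ∀ i μ, Mn i μ = 2 * L ^ mT i) (hk : ∀ i, 1 ≤ kk i) (hM : ∀ i, 1 ≤ (gf i).M)
    (pair : ∀ i, EtaPairing (opGeo (unitTorusGeoS L (kk i) (Mn i) (Msz i)) (X i) (blk i)) (gf i) (Bc i) (Bf i)) {γP : ℝ} (hγP : 0 < γP)
    (hfib : ∀ i, ∃ N : ℕ, N ≠ 0 ∧ ∀ x, (fibre (π i) x).card = N)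
    (hL : ∃ β B ε m m₀ δ a₁ : ℝ, 0 ≤ β ∧ 0 ≤ B ∧ 0 < ε ∧ 0 ≤ m ∧ 0 ≤ m₀ ∧ 0 < δ ∧ 0 < a₁ ∧ ∀ i : I,
      HasMaj (BlockNorm.ofBlocks (unitTorusGeoS L (kk i) (Mn i) (Msz i)) (q i)) (BlockNorm.ofBlocks (unitTorusGeoS L (kk i) (Mn i) (Msz i)) (q i)) (Gc i)
        (fun y y' => β * Real.exp (-(δ * (unitTorusGeoS L (kk i) (Mn i) (Msz i)).dist y y'))) ∧
      HasMaj (BlockNorm.ofBlocks (unitTorusGeoS L (kk i) (Mn i) (Msz i)) (q i ∘ π i)) (BlockNorm.ofBlocks (unitTorusGeoS L (kk i) (Mn i) (Msz i)) (q i ∘ π i)) (Gf i)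
        (fun y y' => β * Real.exp (-(δ * (unitTorusGeoS L (kk i) (Mn i) (Msz i)).dist y y'))) ∧
      HasMaj (BlockNorm.ofBlocks (unitTorusGeoS L (kk i) (Mn i) (Msz i)) (q i)) (BlockNorm.ofBlocks (unitTorusGeoS L (kk i) (Mn i) (Msz i)) (q i ∘ π i))
        (idef (pull (π i)) (pull (π i)) (Gf i) (Gc i)) (fun y y' => m₀ * ((L : ℝ) ^ kk i) ^ (-γP) * Real.exp (-(δ * (unitTorusGeoS L (kk i) (Mn i) (Msz i)).dist y y'))) ∧
      ∀ (α₀ : ℝ), 0 < α₀ → α₀ ≤ a₁ → ∀ U : (Bf i).Cfg, (Bf i).Reg335 c35 α₀ U →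
        HasMaj (BlockNorm.ofBlocks (unitTorusGeoS L (kk i) (Mn i) (Msz i)) (q i)) (BlockNorm.ofBlocks (unitTorusGeoS L (kk i) (Mn i) (Msz i)) (q i))
          (Xco i ((pair i).avg U)) (fun y y' => B * Real.exp (-(δ * (unitTorusGeoS L (kk i) (Mn i) (Msz i)).dist y y'))) ∧
        HasMaj (BlockNorm.ofBlocks (unitTorusGeoS L (kk i) (Mn i) (Msz i)) (q i ∘ π i)) (BlockNorm.ofBlocks (unitTorusGeoS L (kk i) (Mn i) (Msz i)) (q i ∘ π i)) (Xfo i U)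
          (fun y y' => B * Real.exp (-(δ * (unitTorusGeoS L (kk i) (Mn i) (Msz i)).dist y y'))) ∧
        HasMaj (BlockNorm.ofBlocks (unitTorusGeoS L (kk i) (Mn i) (Msz i)) (q i)) (BlockNorm.ofBlocks (unitTorusGeoS L (kk i) (Mn i) (Msz i)) (q i))
          (Xco i ((pair i).avg U) - Gc i) (fun y y' => ε * α₀ * Real.exp (-(δ * (unitTorusGeoS L (kk i) (Mn i) (Msz i)).dist y y'))) ∧
        HasMaj (BlockNorm.ofBlocks (unitTorusGeoS L (kk i) (Mn i) (Msz i)) (q i ∘ π i)) (BlockNorm.ofBlocks (unitTorusGeoS L (kk i) (Mn i) (Msz i)) (q i ∘ π i))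
          (Xfo i U - Gf i) (fun y y' => ε * α₀ * Real.exp (-(δ * (unitTorusGeoS L (kk i) (Mn i) (Msz i)).dist y y'))) ∧
        HasMaj (BlockNorm.ofBlocks (unitTorusGeoS L (kk i) (Mn i) (Msz i)) (q i)) (BlockNorm.ofBlocks (unitTorusGeoS L (kk i) (Mn i) (Msz i)) (q i ∘ π i))
          (idef (pull (π i)) (pull (π i)) (Xfo i U) (Xco i ((pair i).avg U)))
          (fun y y' => m * ((L : ℝ) ^ kk i) ^ (-γP) * Real.exp (-(δ * (unitTorusGeoS L (kk i) (Mn i) (Msz i)).dist y y')))) :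
    NE2PlusSite d' p c35 (fun i => (⟨opGeo (unitTorusGeoS L (kk i) (Mn i) (Msz i)) (X i) (blk i), gf i, Bc i, Bf i, pair i⟩ : PairedInstance))
      (sSiteExOn Mn kk mm Msz X blk gf Bc Bf aS pair (fun i U => siteEntries (Mn i) (sitePert365 (Mn i) (q i ∘ π i) (Gf i) (Xfo i U)))
        (fun i V => siteEntries (Mn i) (sitePert365 (Mn i) (q i) (Gc i) (Xco i V)))) :=
  ne2PlusSite_sSiteExOn_of_letters Mn kk mm Msz X blk gf Bc Bf hLodd hL2 haS c35 d' p hMnT hk hM pair _ _ hγP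
    (siteLetters_of_dressedLetters (L := L) Mn kk Msz Xc Xf q π Bc Bf (fun i => (pair i).avg) Gc Gf Xco Xfo c35 hfib hL)

end Socket

end Summit.QuantumFields.YangMills.BalabanUVNodes.N15.SiteLayerBg

end
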